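import Mathlib

/-!
# Route ConvexRankGates — crux `LinAlgGateBlind` (stmt-PneNP-10681), support:
# Gál's rank measure for span programs with arbitrary row labels

Line `perm-door-lifted-closure-programs` of the crux chain (`Cruxes/LinAlgGateBlind/Lines/…`) walks a
`{∧,∨} + PERM + GRANK` circuit dag and certifies every span node by GÁL'S RANK MEASURE with the
children's wire functions as row labels — its registered stub `stub_labelledRankMeasure :
LabelledRankMeasure` ("provable now, M"). This file proves that statement, definition-free and
literally (the body of the line's `LabelledRankMeasure`), so the stub there is
`exact labelledRankMeasure`:

* `rank_add_le'`, `rank_sum_le'` — subadditivity of `Matrix.rank` over a field.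
* `labelledRankMeasure` — **Gál's rank-one decomposition with labels.** Let a span program over a
  field `F` have rows `rows i ∈ F^d` switched on at input `x` iff `lab i x = 1`, target `t`, and accept
  exactly `f⁻¹(1)` (`f x = 1 ↔ t ∈ span {rows i : lab i x = 1}`). Then for all `U ⊆ f⁻¹(1)`,
  `V ⊆ f⁻¹(0)` and every matrix `A` on `U × V`,
  `rank A ≤ Σ_i rank (A ∘ 1[lab i u = 1 ∧ lab i v = 0])`.
  Proof (A. Gál, *A characterization of span program size and improved lower bounds for monotone
  span programs*, Comput. Complexity 10 (2001), proof of Thm 3.1, with literals replaced by arbitrary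
  labels — the argument does not look at the labels): an accepted `u` gives coefficients `c(u)`
  supported on its switched-on rows with `Σ_i c_i(u) rows i = t`; a rejected `v` gives a functional
  `φ_v` killing `v`'s switched-on rows with `φ_v t = 1` (`Submodule.exists_dual_map_eq_bot_of_notMem`);
  applying `φ_v` yields `1 = Σ_i [lab i u = 1 ∧ lab i v = 0] c_i(u) φ_v(rows i)`, whence
  `A = Σ_i diag(c_i) · (A ∘ 1_{R_i}) · diag(φ_·(rows i))` and `rank A ≤ Σ_i rank (A ∘ 1_{R_i})`.
  (The monotonicity hypothesis on the labels, part of the line's statement, is not used.)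
-/

namespace Summit.PneNP.PneNP.Theorems

open Finset Matrix

/-- Subadditivity of `Matrix.rank` over a field: `rank (A + B) ≤ rank A + rank B`. [folklore] -/
theorem rank_add_le' {K : Type*} [Field K] {m n : Type*} [Fintype n] (A B : Matrix m n K) :
    (A + B).rank ≤ A.rank + B.rank := by
  unfold Matrix.rank
  rw [Matrix.mulVecLin_add]
  calc Module.finrank K (LinearMap.range (A.mulVecLin + B.mulVecLin))
      ≤ Module.finrank K ↥(LinearMap.range A.mulVecLin ⊔ LinearMap.range B.mulVecLin) := by
        apply Submodule.finrank_mono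
        rintro _ ⟨v, rfl⟩
        exact Submodule.add_mem_sup ⟨v, rfl⟩ ⟨v, rfl⟩
    _ ≤ _ := Submodule.finrank_add_le_finrank_add_finrank _ _

/-- `rank (Σᵢ Aᵢ) ≤ Σᵢ rank Aᵢ` over a field. [folklore] -/
theorem rank_sum_le' {K : Type*} [Field K] {m n : Type*} [Fintype n] {η : Type*} (s : Finset η)
    (A : η → Matrix m n K) : (∑ i ∈ s, A i).rank ≤ ∑ i ∈ s, (A i).rank := by
  classical
  induction s using Finset.induction_on with
  | empty => simp
  | insert a s ha ih =>
    rw [Finset.sum_insert ha, Finset.sum_insert ha]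
    exact (rank_add_le' _ _).trans (by omega)

/-- **Gál's rank measure with arbitrary labels** (Gál 2001, proof of Thm 3.1; literally the body of
`LabelledRankMeasure` of line `perm-door-lifted-closure-programs`). If a span program over `F` with
rows `rows i` switched on by label functions `lab i` and target `t` accepts exactly `f⁻¹(1)`, then for
all `U ⊆ f⁻¹(1)`, `V ⊆ f⁻¹(0)` and every `A : Matrix U V F`,
`rank A ≤ Σ_i rank (A ∘ 1[lab i u = 1 ∧ lab i v = 0])`. [folklore] -/
theorem labelledRankMeasure : ∀ (F : Type) [Field F] (ι : Type) [Fintype ι] (d R : ℕ)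
    (rows : Fin R → (Fin d → F)) (lab : Fin R → ((ι → Bool) → Bool)) (t : Fin d → F)
    (f : (ι → Bool) → Bool),
    (∀ i, Monotone (lab i)) →
    (∀ x, f x = true ↔ t ∈ Submodule.span F (rows '' {i | lab i x = true})) →
    ∀ (U V : Finset (ι → Bool)), (∀ u ∈ U, f u = true) → (∀ v ∈ V, f v = false) →
      ∀ A : Matrix U V F,
        A.rank ≤ ∑ i, (Matrix.of fun (u : U) (v : V) =>
          if lab i u = true ∧ lab i v = false then A u v else 0).rank := by
  intro F _ ι _ d R rows lab t f _ hf U V hU hV A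
  classical
  -- accepted `u`: coefficients supported on the switched-on rows
  have hc : ∀ u : U, ∃ c : Fin R → F, (∀ i, lab i u ≠ true → c i = 0) ∧ ∑ i, c i • rows i = t := by
    intro u
    have ht : t ∈ Submodule.span F (rows '' {i | lab i u = true}) := (hf u).1 (hU u u.2)
    rw [Finsupp.mem_span_image_iff_linearCombination] at ht
    obtain ⟨l, hl, hlt⟩ := ht
    refine ⟨l, fun i hi => ?_, ?_⟩
    · by_contra hne
      exact hi ((Finsupp.mem_supported' F l).1 hl i |> fun h => by_contra fun hi' => hne (h hi'))
    · rw [← hlt, Finsupp.linearCombination_apply, Finsupp.sum_fintype]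
      exact fun i => zero_smul F (rows i)
  -- rejected `v`: a functional killing `v`'s switched-on rows, normalised at `t`
  have hφ : ∀ v : V, ∃ φ : Module.Dual F (Fin d → F), φ t = 1 ∧ ∀ i, lab i v = true → φ (rows i) = 0 := by
    intro v
    have ht : t ∉ Submodule.span F (rows '' {i | lab i v = true}) := fun h => by
      have h1 := (hf v).2 h
      rw [hV v v.2] at h1
      exact Bool.false_ne_true h1
    set p : Submodule F (Fin d → F) := Submodule.span F (rows '' {i | lab i v = true}) with hp
    have hq : p.mkQ t ≠ 0 := by
      rwa [Ne, Submodule.mkQ_apply, Submodule.Quotient.mk_eq_zero]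
    obtain ⟨g, hg⟩ := Module.Projective.exists_dual_eq_one F hq
    refine ⟨g.comp p.mkQ, by simpa using hg, fun i hi => ?_⟩
    have hmem : rows i ∈ p := Submodule.subset_span ⟨i, hi, rfl⟩
    rw [LinearMap.comp_apply, Submodule.mkQ_apply, (Submodule.Quotient.mk_eq_zero p).2 hmem, map_zero]
  choose c hc0 hct using hc
  choose φ hφt hφ0 using hφ
  -- the identity `1 = Σ_i [lab i u ∧ ¬ lab i v] c_i(u) φ_v(rows i)`
  have hone : ∀ (u : U) (v : V),
      ∑ i, (if lab i u = true ∧ lab i v = false then c u i * φ v (rows i) else 0) = 1 := by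
    intro u v
    have h := congrArg (φ v) (hct u)
    rw [map_sum, hφt] at h
    rw [← h]
    refine Finset.sum_congr rfl fun i _ => ?_
    rw [map_smul, smul_eq_mul]
    by_cases hu : lab i u = true
    · by_cases hv : lab i v = true
      · simp [hu, hv, hφ0 v i hv]
      · simp [hu, hv]
    · simp [hu, hc0 u i hu]
  -- `A = Σ_i diag(c_i) · (A ∘ 1_{R_i}) · diag(φ_·(rows i))`
  set B : Fin R → Matrix U V F := fun i =>
    Matrix.of fun u v => if lab i u = true ∧ lab i v = false then A u v else 0 with hB
  have hA : A = ∑ i, Matrix.diagonal (fun u : U => c u i) * B i *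
      Matrix.diagonal (fun v : V => φ v (rows i)) := by
    ext u v
    rw [Matrix.sum_apply]
    simp only [Matrix.mul_diagonal, Matrix.diagonal_mul, hB, Matrix.of_apply]
    calc A u v = A u v * 1 := (mul_one _).symm
      _ = A u v * ∑ i, (if lab i u = true ∧ lab i v = false then c u i * φ v (rows i) else 0) := by
          rw [hone]
      _ = ∑ i, c u i * (if lab i u = true ∧ lab i v = false then A u v else 0) * φ v (rows i) := by
          rw [Finset.mul_sum]
          refine Finset.sum_congr rfl fun i _ => ?_
          split_ifs <;> ring
  calc A.rank = (∑ i, Matrix.diagonal (fun u : U => c u i) * B i *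
        Matrix.diagonal (fun v : V => φ v (rows i))).rank := by rw [← hA]
    _ ≤ ∑ i, (Matrix.diagonal (fun u : U => c u i) * B i *
        Matrix.diagonal (fun v : V => φ v (rows i))).rank := rank_sum_le' _ _
    _ ≤ ∑ i, (B i).rank := Finset.sum_le_sum fun i _ =>
        (Matrix.rank_mul_le_left _ _).trans (Matrix.rank_mul_le_right _ _)

end Summit.PneNP.PneNP.Theorems
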